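import Mathlib
import Literature.Computation.Certificates.SemidefiniteRigorousBounds

/-!
# InactiveBlockDepthFloor — spurious dual mass on an INACTIVE block costs depth linearly (hubbard-algo crew (5), D-0042
R2(e); companion of `LevelSlicePairing.lean` and of the cell's block censuses kit j246026 / j246078 / j246086, p1 TARGET.md
§0f; solver-side finite-dimensional linear algebra — NO number and NO bound on any Hubbard quantity lives here)

HONEST FRAMING: first certified bounds; not a superconductivity verdict. This file books the quantitative form of
complementarity that the cell's tier-S diagnostics kept meeting: by `LevelSlicePairing.pairing_identity` the DEPTH of a
dual-feasible point `z` below the optimum equals its pairing `Σ_k ⟨S*_k, Z_k⟩` with the optimal primal slack, a sum of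
nonnegative block terms; on a block where the primal optimum is FULL RANK (`S*_k ⪰ d·I`, `d > 0`; an 'inactive' block,
`Z*_k = 0` — 46 of 85 blocks at the cell's M instance, 83 of 157 at XL, 3.2–3.3 % of the cone either way) any dual mass
`tr Z_k` a first-order iterate still carries costs depth `≥ d · tr Z_k`. (At M the tier-S start carried 16 % of its depth
on two such n = 20 blocks — kit j246026; zeroing it by hand does not help a first-order re-polish — kit j246086 — because
the equality rows couple it to the big blocks; that is an empirical statement and is NOT claimed here.)

PROVED (all over `ℝ`, blocks indexed by a `Fintype`):
* `blockPairing_nonneg` — each `⟨S_k, Z_k⟩ = tr (S_k Z_k) ≥ 0` for PSD `S_k, Z_k`, hence the blockwise pairing is `≥ 0`;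
* `block_le_blockPairing` — one block's term is at most the whole pairing;
* `depthFloor_of_inactiveBlock` — if `S_j − d·1 ⪰ 0` on some block `j` then `d · tr Z_j ≤ Σ_k tr (S_k Z_k)`: the depth floor;
* `inactiveBlock_zero_of_zero_depth` — at depth 0 (an optimal dual) a block with `S_j − d·1 ⪰ 0`, `d > 0` has `tr Z_j = 0`
  (so `Z_j = 0`): strict complementarity read in the direction the censuses use ('X-full ⇒ Z = 0').
Ingredients by name: `Literature.Computation.Certificates.trace_mul_nonneg_of_posSemidef` and
`Literature.Computation.Certificates.JanssonChaykinKeil.trace_mul_ge` [JanssonChaykinKeil2008, Lemma 3.1].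
-/

namespace Summit.Ventures.CertifiedManyBodySolver.HubbardAlg.InactiveBlockDepthFloor

open Matrix Finset
open scoped BigOperators

variable {ι : Type*} [Fintype ι] {n : Type*} [Fintype n]

/-- The blockwise complementarity pairing `Σ_k tr (S_k Z_k)` of two block families (same block shape `n` for every
block — the cell's blocks differ in size, which only changes bookkeeping: pad with zero blocks, or read the lemmas per
size class). -/
def blockPairing (S Z : ι → Matrix n n ℝ) : ℝ := ∑ k, trace (S k * Z k)

/-- Unfolding lemma for `blockPairing`. -/
theorem blockPairing_def (S Z : ι → Matrix n n ℝ) : blockPairing S Z = ∑ k, trace (S k * Z k) := rfl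

/-- Each block term is nonnegative, hence so is the pairing. -/
theorem blockPairing_nonneg {S Z : ι → Matrix n n ℝ} (hS : ∀ k, (S k).PosSemidef) (hZ : ∀ k, (Z k).PosSemidef) :
    0 ≤ blockPairing S Z :=
  Finset.sum_nonneg fun k _ => Literature.Computation.Certificates.trace_mul_nonneg_of_posSemidef (hS k) (hZ k)

/-- One block's term is dominated by the whole pairing (the other terms are nonnegative). -/
theorem block_le_blockPairing {S Z : ι → Matrix n n ℝ} (hS : ∀ k, (S k).PosSemidef) (hZ : ∀ k, (Z k).PosSemidef)
    (j : ι) : trace (S j * Z j) ≤ blockPairing S Z := by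
  unfold blockPairing
  exact Finset.single_le_sum (f := fun k => trace (S k * Z k))
    (fun k _ => Literature.Computation.Certificates.trace_mul_nonneg_of_posSemidef (hS k) (hZ k)) (Finset.mem_univ j)

/-- **Depth floor from an inactive block.** If the primal slack family `S` and the dual family `Z` are blockwise PSD and on
block `j` the slack is uniformly positive definite, `S_j − d·1 ⪰ 0`, then `d · tr Z_j ≤ Σ_k tr (S_k Z_k)`. With
`LevelSlicePairing.pairing_identity` (depth = pairing) this reads: dual mass `tr Z_j` left on a block where the primal
optimum is full rank costs depth at least `λ_min(S*_j) · tr Z_j`. -/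
theorem depthFloor_of_inactiveBlock [DecidableEq n] {S Z : ι → Matrix n n ℝ} (hS : ∀ k, (S k).PosSemidef)
    (hZ : ∀ k, (Z k).PosSemidef) {j : ι} {d : ℝ} (hd : (S j - d • (1 : Matrix n n ℝ)).PosSemidef) :
    d * trace (Z j) ≤ blockPairing S Z :=
  (Literature.Computation.Certificates.JanssonChaykinKeil.trace_mul_ge hd (hZ j)).trans (block_le_blockPairing hS hZ j)

/-- The same floor summed over a set `I` of inactive blocks with a common eigenvalue floor `d`:
`d · Σ_{j ∈ I} tr Z_j ≤ Σ_k tr (S_k Z_k)`. -/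
theorem depthFloor_of_inactiveBlocks [DecidableEq n] {S Z : ι → Matrix n n ℝ} (hS : ∀ k, (S k).PosSemidef)
    (hZ : ∀ k, (Z k).PosSemidef) (I : Finset ι) {d : ℝ}
    (hd : ∀ j ∈ I, (S j - d • (1 : Matrix n n ℝ)).PosSemidef) :
    d * ∑ j ∈ I, trace (Z j) ≤ blockPairing S Z := by
  classical
  calc d * ∑ j ∈ I, trace (Z j) = ∑ j ∈ I, d * trace (Z j) := Finset.mul_sum I (fun j => trace (Z j)) d
    _ ≤ ∑ j ∈ I, trace (S j * Z j) :=
        Finset.sum_le_sum fun j hj => Literature.Computation.Certificates.JanssonChaykinKeil.trace_mul_ge (hd j hj) (hZ j)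
    _ ≤ ∑ k, trace (S k * Z k) :=
        Finset.sum_le_sum_of_subset_of_nonneg (Finset.subset_univ I)
          (fun k _ _ => Literature.Computation.Certificates.trace_mul_nonneg_of_posSemidef (hS k) (hZ k))
    _ = blockPairing S Z := rfl

/-- **Inactive ⇒ zero dual block at depth 0.** If the pairing vanishes (an OPTIMAL dual, depth 0 by the pairing identity)
and block `j` has `S_j − d·1 ⪰ 0` with `d > 0`, then `tr Z_j = 0` — and a PSD matrix with zero trace is zero, which is the
reading 'X-full ⇒ Z = 0' of the censuses (kit j246026: at M the 46 X-full blocks are exactly the 46 with Z* = 0). -/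
theorem inactiveBlock_trace_zero_of_zero_pairing [DecidableEq n] {S Z : ι → Matrix n n ℝ} (hS : ∀ k, (S k).PosSemidef)
    (hZ : ∀ k, (Z k).PosSemidef) {j : ι} {d : ℝ} (hdpos : 0 < d)
    (hd : (S j - d • (1 : Matrix n n ℝ)).PosSemidef) (h0 : blockPairing S Z = 0) : trace (Z j) = 0 := by
  have h1 : d * trace (Z j) ≤ 0 := h0 ▸ depthFloor_of_inactiveBlock hS hZ hd
  have h2 : 0 ≤ trace (Z j) := (hZ j).trace_nonneg
  nlinarith

/-- Matrix form of the previous lemma: a PSD block with zero trace is the zero block, so at zero pairing an inactive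
block (`S_j − d·1 ⪰ 0`, `d > 0`) carries `Z_j = 0`. -/
theorem inactiveBlock_zero_of_zero_pairing [DecidableEq n] {S Z : ι → Matrix n n ℝ} (hS : ∀ k, (S k).PosSemidef)
    (hZ : ∀ k, (Z k).PosSemidef) {j : ι} {d : ℝ} (hdpos : 0 < d)
    (hd : (S j - d • (1 : Matrix n n ℝ)).PosSemidef) (h0 : blockPairing S Z = 0) : Z j = 0 :=
  (hZ j).trace_eq_zero_iff.mp (inactiveBlock_trace_zero_of_zero_pairing hS hZ hdpos hd h0)

end Summit.Ventures.CertifiedManyBodySolver.HubbardAlg.InactiveBlockDepthFloor
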